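import Summits.CriticalPhenomena.PercolationContinuityZ3.Theorems.PercNearOneGluingNoHeavyLowerTailSunflowerMultiPetalIsolated
import HarnessLib
import HarnessLib.Audit

/-!
# `NoHeavyLowerTail` (crux stmt-CriticalPhenomena-4575), abstract sunflower cubic, `k` petals: the sub-cube functional `ZKW` and
# RESTRICTION MONOTONICITY for monotone maps into `M_k` (typed conjecture `RestrictionMonotonicityK` ⟹ `PartitionLemmaK`; `k = 3` bridge)

Support file (seat `prim-l12-p2` gen 26; `--supports stmt-CriticalPhenomena-4575`; companion of `…SunflowerMultiPetal` (p338110), `…SunflowerMultiPetalSpectator`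
(p339016), `…SunflowerMultiPetalIsolated` (p339929), `…SunflowerRestrictionSingleton` / `…SunflowerPartitionReduction` (`nested`, `Sunflower.ZP`,
`RestrictionMonotonicity`)).  No `sorry`; nothing is asserted about the crux; the `@[conjecture]` definition is an obligation of the programme, never a fact.
Memo: run/shared/lean/prim/prim-l12/prim-l12-p2/FINDING-g26-MULTIPETAL-COMPONENT-LEMMA.md §2 (census) and §6.

* `MSunflower.ZKW W` — the partition functional of the sub-cube `2^W` (`nested W (s6K ∘ lab)`); `ZKW_univ : ZKW univ = ZK`, `ZKW_empty : ZKW ∅ = 0`.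
* `RestrictionMonotonicityK` ((MZₖ), OPEN, census-clean): `ZKW W ≤ ZKW (insert e W)` for `e ∉ W` — adding a free coordinate never decreases the functional, for
  every number `k` of petals.  CENSUS (memo §2, exact engines `mzcomp.c`, `mz6.c`): all `(A,B)` pairs on `≤ 5` points with the finest AND with the inherited colouring
  (3.9·10⁷ comparisons each), 9.6·10⁶ random comparisons at 6 points: no violation, minimum difference `0`.  For `k = 3` it is prove-1's `RestrictionMonotonicity`
  (`restrictionMonotonicity_of_K`).
* `partitionLemmaK_of_restrictionMonotonicityK` : (MZₖ) ⟹ ★ₖ (one-line induction on the sub-cube from `ZKW ∅ = 0`).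
-/

namespace Summit.CriticalPhenomena.PercolationContinuityZ3.Theorems.SunflowerPartition

open Finset

variable {α : Type*} [DecidableEq α]

/-- `s6K` vanishes on the diagonal. [this work] -/
theorem s6K_diag (k : ℕ) (v : Fin (k + 2)) : s6K k v v v = 0 := by
  unfold s6K tbK
  have h : ¬(v = Fin.last (k + 1) ∧ v = 0) := by
    rintro ⟨h1, h2⟩
    rw [h2] at h1
    have := congrArg Fin.val h1
    simp at this
  simp [h]

namespace MSunflower

variable {k : ℕ} (F : MSunflower k α)

/-- The partition functional of the sub-cube `2^W`: `Σ_{(X,Y,Z) ⊢ W} s6K (lab X) (lab Y) (lab Z)`. [this work] -/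
def ZKW (W : Finset α) : ℤ := nested W fun X Y Z => s6K k (F.lab X) (F.lab Y) (F.lab Z)

/-- On the empty cube the functional vanishes (`s6K` is zero on the diagonal). [this work] -/
theorem ZKW_empty : F.ZKW ∅ = 0 := by
  unfold ZKW
  rw [nested_empty]
  exact s6K_diag k _

/-- On the full cube `ZKW univ = ZK`. [this work] -/
theorem ZKW_univ [Fintype α] : F.ZKW univ = F.ZK := by
  unfold ZKW ZK
  exact (sum_parts_eq_nested_univ (g := fun X Y Z => s6K k (F.lab X) (F.lab Y) (F.lab Z))).symm

/-- For `k = 3` the sub-cube functional of `ofSunflower F` is prove-1's `F.ZP W ∅ ∅ ∅`. [this work] -/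
theorem ZKW_ofSunflower (F : Sunflower α) (W : Finset α) : (ofSunflower F).ZKW W = F.ZP W ∅ ∅ ∅ := by
  rw [F.ZP_empty_eq_nested]
  unfold ZKW nested
  refine sum_congr rfl fun X _ => sum_congr rfl fun Y _ => ?_
  show s6K 3 ((ofSunflower F).lab X) ((ofSunflower F).lab Y) ((ofSunflower F).lab ((W \ X) \ Y)) =
    s6H (F.lab X) (F.lab Y) (F.lab ((W \ X) \ Y))
  rw [lab_ofSunflower, lab_ofSunflower, lab_ofSunflower, s6K_three]

end MSunflower

/-- **(MZₖ) RESTRICTION MONOTONICITY FOR `k` PETALS** (this work; OPEN; census-clean — header): for every monotone map into `M_k`, every sub-cube `W` and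
every `e ∉ W`, `ZKW W ≤ ZKW (insert e W)`.  Implies `PartitionLemmaK` (`partitionLemmaK_of_restrictionMonotonicityK`); specialises to
`RestrictionMonotonicity` (`restrictionMonotonicity_of_K`).  An obligation, never a fact: use as `(h : RestrictionMonotonicityK)`. [status: open] -/
@[conjecture] def RestrictionMonotonicityK : Prop :=
  ∀ (k : ℕ) (α : Type) [Fintype α] [DecidableEq α] (F : MSunflower k α) (W : Finset α) (e : α), e ∉ W → F.ZKW W ≤ F.ZKW (insert e W)

/-- **(MZₖ) ⟹ ★ₖ** by induction on the sub-cube. [this work] -/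
theorem partitionLemmaK_of_restrictionMonotonicityK (h : RestrictionMonotonicityK) : PartitionLemmaK := by
  intro k α _ _ F
  rw [← F.ZKW_univ]
  have main : ∀ W : Finset α, 0 ≤ F.ZKW W := by
    intro W
    induction W using Finset.induction_on with
    | empty => rw [F.ZKW_empty]
    | insert e W' he ih => exact le_trans ih (h k α F W' e he)
  exact main univ

/-- **(MZₖ) ⟹ (MZ)**: the `k = 3` specialisation is prove-1's `RestrictionMonotonicity`. [this work] -/
theorem restrictionMonotonicity_of_K (h : RestrictionMonotonicityK) : RestrictionMonotonicity := by
  intro α _ _ F W e he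
  rw [← MSunflower.ZKW_ofSunflower, ← MSunflower.ZKW_ofSunflower]
  exact h 3 α (MSunflower.ofSunflower F) W e he

end Summit.CriticalPhenomena.PercolationContinuityZ3.Theorems.SunflowerPartition
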